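import Summits.CriticalPhenomena.PercolationContinuityZ3.Theorems.FK.Transplant.FHSlabThresholdMono
import Summits.CriticalPhenomena.PercolationContinuityZ3.Theorems.FK.Transplant.FHSlabWidthMono
import Summits.CriticalPhenomena.PercolationContinuityZ3.Theorems.FK.CriticalPointBounds
import Mathlib.Topology.Order.MonotoneConvergence
import HarnessLib

/-!
# FRONTIER TRANSPLANT, binder 1 (FH) calibration leaf IV (L, gap) — Grimmett's (5.102) limit `p̂_c(q, L) ↓ p̂_c(q)`,
# `0 < p̂_c(q, L), p̂_c(q) < 1` at every width, and the K1 GAP `p̂_c(q) - p_c(q)` as a function of `q`: non-negative,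
# `1/2`-Lipschitz on `[1, ∞)`; hence the set of cluster weights at which Conjecture (5.103) holds is CLOSED, and —
# given Bodineau's theorem `p̂_c(2) = p_c(2)` — `p̂_c(q) - p_c(q) ≤ |q - 2|/2` and free slab percolation holds at the
# SAME `p` throughout the explicit window `p > p_c(q) + |q - 2|/2`, for every `q ≥ 1`, `d ≥ 3`

Support file (`--supports stmt-CriticalPhenomena-4575`, helper) of the FRONTIER TRANSPLANT sub-cell
(`fk-continuity/transplant/`, seat `prim-bschramm-fkt-p2`); builds on p205010 (kernel theorem, internal audit signed;
external expert review pending). No definitions, no named facts introduced, no sorries; standard axioms. Sequel of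
`Transplant/FHSlabThresholdMono.lean` (the `q`-variable) and of T1t-D `Transplant/FHSlabWidthMono.lean` (the width).

Registered R65 (cell INBOX l.4822, 2026-08-23); registry row T1q; lead label T1q-B (fkt-lead L23, l.4806).

HONEST FRAMING (page 1, cell rule). The transplant's theorem of record `ufsc0_of_freeBoundaryHypothesis_r3`
(p248245, « 2 / 0 ☑ ») is CONDITIONAL on FH AND on TP_FK = `KNFreeTargetHittable d q p`, both OPEN at the same `p`
for `q > 1` near `p_c(q)` (⇔ GRC Conj. (5.103) via K1; barrier note
`Literature.Barriers.CriticalPhenomena.SamePFreeBoundaryCriteria`, FBN-01, cited first: its objects `Π(p, L)`,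
`p̂_c(q, L)`, `p̂_c(q)` and its NAMED FACT `Bodineau2005_slabThreshold`); the transplant is a typed reduction, not a
proof of FK continuity. THIS FILE DOES NOT CHANGE THAT. It is a CALIBRATION leaf on binder 1's K1 interval
`[p_c(q), p̂_c(q)]` (whose collapse IS Conjecture (5.103)): its LENGTH is a continuous, `1/2`-Lipschitz function of
the cluster weight (both end-points move at speed `≤ 1/4`: `FHSlabThresholdMono` and the tree's `CriticalPointBounds`),
so (5.103) holds on a CLOSED set of `q`, and near the Ising point `q = 2` — where Bodineau's theorem (displayed
hypothesis `hB`, a published theorem the tree does not prove) makes the length `0` — the interval is short: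
`p̂_c(q) ≤ p_c(q) + |q - 2|/2`, i.e. free slab percolation `Π(p, L)` holds at the same `p` for every
`p > p_c(q) + |q - 2|/2` (leaf II `fh_of_fkSlabPercolation`, by name and NOT imported, then gives binder 1 there).
Conjecture (5.103) itself (`p̂_c(q) = p_c(q)`) is NOT asserted for any `q`; unconditionally the tree knows only
`0 ≤ p̂_c(q) - p_c(q)`, its Lipschitz modulus, and T1t's `p̂_c(q) < 1`. The file concludes NO `FH` (R61 (α)
precedent; the record file is not in its import cone); NOT a rule-5 discharge of binder 1, NOT a re-cut, NOT `_r4`,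
nothing about TP_FK; `_r3` « 2 / 0 ☑ », n_open = 2, BINDER-OWNERS, FO-19 NO-GO unchanged.

## What is proved (namespace `Summit.CriticalPhenomena.PercolationContinuityZ3.Theorems.FK`)

§1 The width: `fkSlabCriticalProb_le_fkSlabCriticalProbAt` (`p̂_c(q) ≤ p̂_c(q, L)`), **`fkSlabCriticalProbAt_antitone`**
(`L ↦ p̂_c(q, L)` non-increasing — T1t-D's width monotonicity of `Π` on `(0, 1]`, the corner `p = 0` by density),
**`tendsto_fkSlabCriticalProbAt`** (Grimmett's (5.102) `p̂_c(q) = lim_{L→∞} p̂_c(q, L)` IS the barrier note's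
one-line infimum `inf{p : ∃ L, Π(p, L)}` of Severo), `exists_fkSlabPercolation_of_fkSlabCriticalProb_lt`
(`p̂_c(q) < p ≤ 1 ⟹ ∃ L, Π(p, L)`), **`fkSlabCriticalProbAt_lt_one`** (every width, `d ≥ 2`),
`rcCriticalProb_le_fkSlabCriticalProbAt`, `fkSlabCriticalProb_pos`, **`fkSlabCriticalProb_mem_Ioo` /
`fkSlabCriticalProbAt_mem_Ioo`** ((5.9) for the slab thresholds: `0 < p̂_c(q) ≤ p̂_c(q, L) < 1`, `q ≥ 1`, `d ≥ 2`).
§2 The K1 gap: `slabGap_nonneg`, **`abs_slabGap_sub_le`** (`|gap(q) - gap(q')| ≤ |q - q'|/2`), `lipschitzOnWith_slabGap`,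
`continuousOn_slabGap`, **`isClosed_setOf_fkSlabCriticalProb_eq_rcCriticalProb`** (the (5.103)-set
`{q ≥ 1 : p̂_c(q) = p_c(q)}` is closed), `exists_fkSlabPercolation_of_gt_gap` (unconditional window
`p > p_c(q) + gap(q') + |q - q'|/2`).
§3 Given `hB : Bodineau2005_slabThreshold`, `d ≥ 3`, every `q ≥ 1`: **`slabGap_le_of_bodineau`**
(`p̂_c(q) - p_c(q) ≤ |q - 2|/2`), `fkSlabCriticalProb_le_of_bodineau` (`p̂_c(q) ≤ p_c(q) + |q - 2|/2`),
**`exists_fkSlabPercolation_of_bodineau_window`** (`p ∈ [0,1]`, `p_c(q) + |q - 2|/2 < p ⟹ ∃ L, Π(p, L)`),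
`two_mem_setOf_fkSlabCriticalProb_eq_rcCriticalProb` (the (5.103)-set contains `2`).

## References

* G. Grimmett, *The Random-Cluster Model*, Springer 2006: Thm. (3.21); §5.1 Thm. (5.5) (5.6)–(5.9), Thm. (5.10)
  and its proof (p. 101); §5.7 (5.102), Conj. (5.103). [Grimmett2006]
* T. Bodineau, PTRF 132 (2005) 83–118, arXiv:math/0309300, Thm. 2.1. [Bodineau2005]
* F. Severo, ECP 29 (2024), arXiv:2312.06831, §1 (definition of `p̂_c`), Thm. 1.1. [Severo2024]
-/

noncomputable section

open scoped Classical NNReal Topology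
open MeasureTheory Filter

namespace Summit.CriticalPhenomena.PercolationContinuityZ3.Theorems.FK

open Literature.Probability.Percolation Literature.Probability.LatticeModels
open Literature.Barriers.CriticalPhenomena

variable {d : ℕ}

/-! ### 1. The width: `p̂_c(q, L)` is non-increasing in `L` and tends to `p̂_c(q)` — Grimmett's (5.102); (5.9) -/

/-- `p̂_c(q) ≤ p̂_c(q, L)` for every width (`q > 0`). [cite: Grimmett2006, §5.7 eq. (5.102)] [cite: Severo2024, §1 (definition of p̂_c)] -/
theorem fkSlabCriticalProb_le_fkSlabCriticalProbAt {q : ℝ} (hq : 0 < q) (L : ℕ) :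
    fkSlabCriticalProb d q ≤ fkSlabCriticalProbAt d q L :=
  csInf_le_csInf ⟨0, fun _ hp => hp.1.1⟩ ⟨1, one_mem_fkSlabCriticalSetAt hq L⟩ fun _ hp => ⟨hp.1, L, hp.2⟩

/-- **`L ↦ p̂_c(q, L)` is non-increasing** (`q ≥ 1`) — Grimmett's "it is thus natural to define (5.102)". From
T1t-D's width monotonicity of `Π` on `(0, 1]`; a percolating `p = 0` at width `L` is handled by density (every
`a ∈ (p, 1]` percolates at width `L`, hence at `L'`, so `p̂_c(q, L') ≤ a`).
[cite: Grimmett2006, §5.7 eq. (5.102) ("Π(p, L) ⇒ Π(p', L') if p ≤ p' and L ≤ L'")] -/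
theorem fkSlabCriticalProbAt_antitone {q : ℝ} (hq : 1 ≤ q) : Antitone (fkSlabCriticalProbAt d q) := by
  intro L L' hLL
  refine le_csInf ⟨1, one_mem_fkSlabCriticalSetAt (one_pos.trans_le hq) L⟩ ?_
  rintro p ⟨hp, hL⟩
  refine le_of_forall_gt_imp_ge_of_dense fun a ha => ?_
  by_cases ha1 : a ≤ 1
  · have haI : a ∈ Set.Ioc (0 : ℝ) 1 := ⟨hp.1.trans_lt ha, ha1⟩
    exact fkSlabCriticalProbAt_le_of_fkSlabPercolation haI hq hLL (hL.mono hp ⟨haI.1.le, ha1⟩ ha.le hq)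
  · exact (fkSlabCriticalProbAt_mem_Icc (one_pos.trans_le hq) L').2.trans (le_of_not_ge ha1)

/-- **`p̂_c(q, L) → p̂_c(q)` as `L → ∞`** (`q ≥ 1`): Grimmett's (5.102) `p̂_c(q) = lim_{L→∞} p̂_c(q, L)` and the barrier
note's one-line `p̂_c(q) = inf{p : ∃ L, Π(p, L)}` (Severo) are the same number — the limit of a non-increasing sequence
bounded below is its infimum (FBN-01 `fkSlabCriticalProb_eq_iInf`). [cite: Grimmett2006, §5.7 eq. (5.102)] [cite: Severo2024, §1 (definition of p̂_c)] -/
theorem tendsto_fkSlabCriticalProbAt {q : ℝ} (hq : 1 ≤ q) :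
    Tendsto (fun L => fkSlabCriticalProbAt d q L) atTop (𝓝 (fkSlabCriticalProb d q)) := by
  rw [fkSlabCriticalProb_eq_iInf (one_pos.trans_le hq)]
  exact tendsto_atTop_ciInf (fkSlabCriticalProbAt_antitone hq)
    ⟨0, by rintro _ ⟨L, rfl⟩; exact (fkSlabCriticalProbAt_mem_Icc (one_pos.trans_le hq) L).1⟩

/-- **Above the slab threshold, `Π` holds at the same `p`**: `p̂_c(q) < p`, `p ∈ [0, 1]`, `q ≥ 1` give a width `L`
with `Π(p, L)` (some member of the defining set lies below `p`; `Π(·, L)` is monotone in `p`).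
[cite: Grimmett2006, §5.7 eq. (5.102)] [cite: Severo2024, §1 (definition of p̂_c)] -/
theorem exists_fkSlabPercolation_of_fkSlabCriticalProb_lt {q : ℝ} (hq : 1 ≤ q) {p : ℝ}
    (hp : p ∈ Set.Icc (0 : ℝ) 1) (hlt : fkSlabCriticalProb d q < p) : ∃ L : ℕ, FKSlabPercolation d p q L := by
  obtain ⟨p', ⟨hp', L, hL⟩, hp'p⟩ :=
    exists_lt_of_csInf_lt ⟨1, one_mem_fkSlabCriticalSet (one_pos.trans_le hq)⟩ hlt
  exact ⟨L, hL.mono hp' hp hp'p.le hq⟩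

/-- **`p̂_c(q, L) < 1` for EVERY width `L`** (`q ≥ 1`, `d ≥ 2`): T1t's `Π(p, 0)` below `p = 1` at high density
(`exists_fkSlabPercolation`), pushed to the positive parameter `(p+1)/2 < 1` and then to width `L` (T1t-D).
[cite: Grimmett2006, §5.7 ("Clearly p_c(q) ≤ p̂_c(q) < 1"), eq. (5.102)] -/
theorem fkSlabCriticalProbAt_lt_one (hd : 2 ≤ d) {q : ℝ} (hq : 1 ≤ q) (L : ℕ) : fkSlabCriticalProbAt d q L < 1 := by
  obtain ⟨p, hp1, hSP⟩ := exists_fkSlabPercolation hd hq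
  have hp0 : 0 ≤ (p : ℝ) := p.2.1
  set a : ℝ := ((p : ℝ) + 1) / 2 with ha
  have ha0 : 0 < a := by rw [ha]; linarith
  have hpa : (p : ℝ) ≤ a := by rw [ha]; linarith
  have ha1 : a < 1 := by rw [ha]; linarith
  have hPi : FKSlabPercolation d a q L :=
    fkSlabPercolation_of_zero_width ⟨ha0, ha1.le⟩ hq (hSP.mono p.2 ⟨ha0.le, ha1.le⟩ hpa hq) L
  exact (fkSlabCriticalProbAt_le ⟨ha0.le, ha1.le⟩ hPi).trans_lt ha1

/-- `p_c(q) ≤ p̂_c(q, L)` for every width (`d ≥ 1`, `q ≥ 1`). [cite: Grimmett2006, §5.7 ("Clearly p_c(q) ≤ p̂_c(q)"), eq. (5.102)] -/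
theorem rcCriticalProb_le_fkSlabCriticalProbAt (hd : 1 ≤ d) {q : ℝ} (hq : 1 ≤ q) (L : ℕ) :
    rcCriticalProb d q ≤ fkSlabCriticalProbAt d q L :=
  (rcCriticalProb_le_fkSlabCriticalProb hd hq).trans
    (fkSlabCriticalProb_le_fkSlabCriticalProbAt (one_pos.trans_le hq) L)

/-- **`0 < p̂_c(q)`** (`d ≥ 1`, `q ≥ 1`): from `0 < p_c(q) ≤ p̂_c(q)` (tree `rcCriticalProb_pos`, FBN-01).
[cite: Grimmett2006, Thm. (5.5) (5.9); §5.7 ("Clearly p_c(q) ≤ p̂_c(q)")] -/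
theorem fkSlabCriticalProb_pos (hd : 1 ≤ d) {q : ℝ} (hq : 1 ≤ q) : 0 < fkSlabCriticalProb d q :=
  (rcCriticalProb_pos hd hq).trans_le (rcCriticalProb_le_fkSlabCriticalProb hd hq)

/-- **(5.9) for the slab threshold: `0 < p̂_c(q) < 1`** for every `q ≥ 1` on `ℤ^d`, `d ≥ 2` (T1t-C
`fkSlabCriticalProb_lt_one` for the right end). [cite: Grimmett2006, Thm. (5.5) (5.9); §5.7 ("Clearly p_c(q) ≤ p̂_c(q) < 1")] -/
theorem fkSlabCriticalProb_mem_Ioo (hd : 2 ≤ d) {q : ℝ} (hq : 1 ≤ q) :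
    fkSlabCriticalProb d q ∈ Set.Ioo (0 : ℝ) 1 :=
  ⟨fkSlabCriticalProb_pos (by omega) hq, fkSlabCriticalProb_lt_one hd hq⟩

/-- **`0 < p̂_c(q, L) < 1`** for every width `L`, `q ≥ 1`, `d ≥ 2`. [cite: Grimmett2006, Thm. (5.5) (5.9); §5.7 eq. (5.102)] -/
theorem fkSlabCriticalProbAt_mem_Ioo (hd : 2 ≤ d) {q : ℝ} (hq : 1 ≤ q) (L : ℕ) :
    fkSlabCriticalProbAt d q L ∈ Set.Ioo (0 : ℝ) 1 :=
  ⟨(fkSlabCriticalProb_pos (by omega) hq).trans_le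
      (fkSlabCriticalProb_le_fkSlabCriticalProbAt (one_pos.trans_le hq) L),
    fkSlabCriticalProbAt_lt_one hd hq L⟩

/-! ### 2. The K1 gap `p̂_c(q) - p_c(q)` as a function of `q` -/

/-- The K1 gap is non-negative: `0 ≤ p̂_c(q) - p_c(q)` (`d ≥ 1`, `q ≥ 1`; FBN-01 `rcCriticalProb_le_fkSlabCriticalProb`).
[cite: Grimmett2006, §5.7 ("Clearly p_c(q) ≤ p̂_c(q)")] -/
theorem slabGap_nonneg (hd : 1 ≤ d) {q : ℝ} (hq : 1 ≤ q) : 0 ≤ fkSlabCriticalProb d q - rcCriticalProb d q :=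
  sub_nonneg.2 (rcCriticalProb_le_fkSlabCriticalProb hd hq)

/-- **The K1 gap is `1/2`-Lipschitz in `q`**: `|(p̂_c(q) - p_c(q)) - (p̂_c(q') - p_c(q'))| ≤ |q - q'|/2` for
`q, q' ≥ 1` (both end-points move at speed `≤ 1/4`: `abs_fkSlabCriticalProb_sub_le` and the tree's
`abs_rcCriticalProb_sub_le`). [cite: Grimmett2006, Thm. (5.10) (proof, p. 101); §5.7 eq. (5.102), Conj. (5.103)] -/
theorem abs_slabGap_sub_le {q q' : ℝ} (hq : 1 ≤ q) (hq' : 1 ≤ q') :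
    |(fkSlabCriticalProb d q - rcCriticalProb d q) - (fkSlabCriticalProb d q' - rcCriticalProb d q')| ≤
      |q - q'| / 2 := by
  have h1 := abs_fkSlabCriticalProb_sub_le (d := d) hq hq'
  have h2 := abs_rcCriticalProb_sub_le (d := d) hq hq'
  calc |(fkSlabCriticalProb d q - rcCriticalProb d q) - (fkSlabCriticalProb d q' - rcCriticalProb d q')|
      = |(fkSlabCriticalProb d q - fkSlabCriticalProb d q') - (rcCriticalProb d q - rcCriticalProb d q')| := by
        ring_nf
    _ ≤ |fkSlabCriticalProb d q - fkSlabCriticalProb d q'| + |rcCriticalProb d q - rcCriticalProb d q'| :=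
        abs_sub _ _
    _ ≤ |q - q'| / 4 + |q - q'| / 4 := add_le_add h1 h2
    _ = |q - q'| / 2 := by ring

/-- **`q ↦ p̂_c(q) - p_c(q)` is Lipschitz with constant `1/2` on `[1, ∞)`.** [cite: Grimmett2006, Thm. (5.10); §5.7 eq. (5.102), Conj. (5.103)] -/
theorem lipschitzOnWith_slabGap (d : ℕ) :
    LipschitzOnWith (1 / 2 : ℝ≥0) (fun q => fkSlabCriticalProb d q - rcCriticalProb d q) (Set.Ici 1) := by
  refine LipschitzOnWith.of_dist_le_mul fun q hq q' hq' => ?_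
  rw [Real.dist_eq, Real.dist_eq]
  have h := abs_slabGap_sub_le (d := d) (Set.mem_Ici.1 hq) (Set.mem_Ici.1 hq')
  have e : ((1 / 2 : ℝ≥0) : ℝ) = 1 / 2 := by norm_num
  rw [e]
  linarith

/-- `q ↦ p̂_c(q) - p_c(q)` is continuous on `[1, ∞)`. [cite: Grimmett2006, Thm. (5.10); §5.7 eq. (5.102), Conj. (5.103)] -/
theorem continuousOn_slabGap (d : ℕ) :
    ContinuousOn (fun q => fkSlabCriticalProb d q - rcCriticalProb d q) (Set.Ici 1) :=
  (lipschitzOnWith_slabGap d).continuousOn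

/-- **The set of cluster weights at which Conjecture (5.103) `p̂_c(q) = p_c(q)` holds is CLOSED in `[1, ∞)`**
(every `d`): both sides are continuous in `q`. So (5.103) on a dense set of `q ≥ 1` would give it for every
`q ≥ 1`; in print the set is known to contain `q = 1` (Grimmett–Marstrand) and `q = 2` (Bodineau, `d ≥ 3`) only —
the conjecture itself is NOT asserted here. [cite: Grimmett2006, §5.7 Conj. (5.103), Thm. (5.10)] -/
theorem isClosed_setOf_fkSlabCriticalProb_eq_rcCriticalProb (d : ℕ) :
    IsClosed {q : ℝ | 1 ≤ q ∧ fkSlabCriticalProb d q = rcCriticalProb d q} := by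
  have h := (continuousOn_slabGap d).preimage_isClosed_of_isClosed isClosed_Ici
    (isClosed_singleton (x := (0 : ℝ)))
  convert h using 1
  ext q
  simp only [Set.mem_setOf_eq, Set.mem_inter_iff, Set.mem_Ici, Set.mem_preimage, Set.mem_singleton_iff,
    sub_eq_zero]

/-- **Unconditional window at the same `p`**: for `q, q' ≥ 1`, `d ≥ 1` and `p ∈ [0, 1]` with
`p_c(q) + (p̂_c(q') - p_c(q')) + |q - q'|/2 < p`, free slab percolation `Π(p, L)` holds at cluster weight `q` for
some width — the gap at `q` is at most the gap at `q'` plus `|q - q'|/2`. [cite: Grimmett2006, §5.7 eq. (5.102), Conj. (5.103); Thm. (5.10)] -/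
theorem exists_fkSlabPercolation_of_gt_gap {q q' : ℝ} (hq : 1 ≤ q) (hq' : 1 ≤ q') {p : ℝ}
    (hp : p ∈ Set.Icc (0 : ℝ) 1)
    (hlt : rcCriticalProb d q + (fkSlabCriticalProb d q' - rcCriticalProb d q') + |q - q'| / 2 < p) :
    ∃ L : ℕ, FKSlabPercolation d p q L := by
  refine exists_fkSlabPercolation_of_fkSlabCriticalProb_lt hq hp (lt_of_le_of_lt ?_ hlt)
  have h := (le_abs_self _).trans (abs_slabGap_sub_le (d := d) hq hq')
  linarith

/-! ### 3. Near the Ising point, given Bodineau's theorem `p̂_c(2) = p_c(2)` (`d ≥ 3`) -/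

/-- **Near the Ising point the K1 interval is short — given Bodineau's theorem**: for `d ≥ 3` and every `q ≥ 1`,
`p̂_c(q) - p_c(q) ≤ |q - 2|/2`, CONDITIONAL on the named fact `hB : Bodineau2005_slabThreshold` (`p̂_c(2) = p_c(2)`,
Bodineau 2005 Thm. 2.1 / Severo 2024 Thm. 1.1 — a published theorem the tree does not prove). Conjecture (5.103)
says the left side is `0`. [cite: Bodineau2005, Thm. 2.1] [cite: Severo2024, Thm. 1.1] [cite: Grimmett2006, §5.7 Conj. (5.103), Thm. (5.10)] -/
theorem slabGap_le_of_bodineau (hB : Bodineau2005_slabThreshold) (hd : 3 ≤ d) {q : ℝ} (hq : 1 ≤ q) :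
    fkSlabCriticalProb d q - rcCriticalProb d q ≤ |q - 2| / 2 := by
  have h := abs_slabGap_sub_le (d := d) hq (by norm_num : (1 : ℝ) ≤ 2)
  rw [hB d hd, sub_self, sub_zero] at h
  exact (le_abs_self _).trans h

/-- Given Bodineau's theorem, `d ≥ 3`: **`p̂_c(q) ≤ p_c(q) + |q - 2|/2`** for every `q ≥ 1`.
[cite: Bodineau2005, Thm. 2.1] [cite: Grimmett2006, §5.7 Conj. (5.103), Thm. (5.10)] -/
theorem fkSlabCriticalProb_le_of_bodineau (hB : Bodineau2005_slabThreshold) (hd : 3 ≤ d) {q : ℝ} (hq : 1 ≤ q) :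
    fkSlabCriticalProb d q ≤ rcCriticalProb d q + |q - 2| / 2 := by
  have h := slabGap_le_of_bodineau hB hd hq
  linarith

/-- **The Bodineau window**: given `hB`, `d ≥ 3`, every `q ≥ 1` and `p ∈ [0, 1]` with `p_c(q) + |q - 2|/2 < p` admit a
width `L` with free slab percolation `Π(p, L)` at the SAME `p` — a same-`p` free-boundary criterion in an explicit
neighbourhood of the supercritical Ising line that closes on `p_c(q)` as `q → 2` (with leaf II's
`fh_of_fkSlabPercolation`, by name, binder 1 `FH d q p` holds there for `d ≥ 3`). CONDITIONAL on the named fact.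
[cite: Bodineau2005, Thm. 2.1] [cite: Severo2024, Thm. 1.1] [cite: Grimmett2006, §5.7 eq. (5.102), Conj. (5.103)] -/
theorem exists_fkSlabPercolation_of_bodineau_window (hB : Bodineau2005_slabThreshold) (hd : 3 ≤ d) {q : ℝ}
    (hq : 1 ≤ q) {p : ℝ} (hp : p ∈ Set.Icc (0 : ℝ) 1) (hlt : rcCriticalProb d q + |q - 2| / 2 < p) :
    ∃ L : ℕ, FKSlabPercolation d p q L :=
  exists_fkSlabPercolation_of_fkSlabCriticalProb_lt hq hp ((fkSlabCriticalProb_le_of_bodineau hB hd hq).trans_lt hlt)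

/-- Given `hB`, `d ≥ 3`: the cluster weight `2` lies in the (closed) set where (5.103) holds. [cite: Bodineau2005, Thm. 2.1] [cite: Grimmett2006, §5.7 Conj. (5.103)] -/
theorem two_mem_setOf_fkSlabCriticalProb_eq_rcCriticalProb (hB : Bodineau2005_slabThreshold) (hd : 3 ≤ d) :
    (2 : ℝ) ∈ {q : ℝ | 1 ≤ q ∧ fkSlabCriticalProb d q = rcCriticalProb d q} :=
  ⟨by norm_num, hB d hd⟩

end Summit.CriticalPhenomena.PercolationContinuityZ3.Theorems.FK

end
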